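import Mathlib

/-!
# `SelfNormalisedSkewness` — negative-side support I: the tree-level skewness of `F_{μν}F_{μν}`
# vanishes in four dimensions

Support file for crux `stmt-QuantumFields-18944` (W₂ of route `ScalingWindowSplit`), from the
birth-vetting refuter's crux attack (refuter-rattack-stmt-QuantumFields-18944, 2026-08-17).

The crux asserts a `k`-uniform floor for the SELF-NORMALISED third cumulant of the lattice action
density `∑_{i<j} Re tr ρ(U_p)` (continuum `F_{μν}F_{μν}`) along every weak-coupling scheme with
polynomial volumes, a polynomial floor and a window; its only stated support is that the floor is
"true for Wick squares of a free field, hence in the Coulomb phase and in the deep UV". This file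
kernel-checks the finite-dimensional identity behind the OPPOSITE fact: for the free Euclidean
Maxwell field in `d = 4` (and for free gluons, colour factors being diagonal) every ODD truncated
correlation function of the Wick square `F_{μν}F_{μν}` vanishes at non-coincident points.

Mechanism. With `⟨A_ν(x)A_σ(0)⟩ = δ_{νσ} D(x)`, `D = |x|⁻²`, the field-strength covariance is
`⟨F_{μν}(x)F_{ρσ}(0)⟩ = -(h ⊙ δ)_{μν,ρσ}`, `h = ∇∇D(x)` symmetric and TRACELESS (`ΔD = 0` away from
`0` — special to `d = 4`). In the plane basis this is the `6 × 6` matrix `K h` below, and `K h`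
ANTICOMMUTES with the Hodge star `S` (`K_anticomm`: it exchanges self-dual and anti-self-dual
2-forms — the traceless-Ricci block of the four-dimensional curvature decomposition). Hence every
cyclic product of an odd number of such covariances has trace zero (`trace_eq_zero_of_anticomm`,
`treeLevelSkewness_vanishes`), while the two-point ring does not vanish (`trace_K_h₀_sq_ne_zero`).
The free-field third cumulant of `O = ∑_{μν} F_{μν}²` at `x, y, z` is `64 · tr K(h₁)K(h₂)K(h₃)`
with `hᵢ` the Hessians of `D` at the three separations, so it is `0`; the single-plane observable
`F₀₁²` has a non-zero triangle (the cancellation needs the full `O(4)`-scalar sum over the six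
planes, which is exactly the crux's `LatticeRep.curvature = actionDensity`).

Consequence recorded on the item (evidence `SkewnessTreeLevel.md`): along deep-UV window schemes
(`a_k ξ_k → ∞`) for any `G`, and along every weak-coupling scheme for `G = U(1)` (Coulomb phase),
the hypotheses of the crux hold while the self-normalised skewness is `O(g²) + O(a²) → 0`
(heuristically), so the crux as typed is expected to fail there; the suggested repair adds the
hypothesis `HasLatticeMassGap r sch Δ` that W₁ supplies (one-scale regime).
-/

namespace Summit.QuantumFields.YangMills.Theorems.SelfNormalisedSkewness.Negative

open Matrix

/-- First index `μ` of the `i`-th coordinate plane of `ℝ⁴`, planes ordered `01, 02, 03, 12, 13, 23`.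
[folklore] -/
def p1 (i : Fin 6) : Fin 4 := if i.val < 3 then 0 else if i.val < 5 then 1 else 2

/-- Second index `ν` of the `i`-th coordinate plane of `ℝ⁴` (`01, 02, 03, 12, 13, 23`). [folklore] -/
def p2 (i : Fin 6) : Fin 4 :=
  if i.val = 0 then 1 else if i.val = 1 then 2 else if i.val = 2 then 3 else if i.val = 3 then 2 else 3

/-- Kronecker delta on `Fin 4`. [folklore] -/
def δ (i j : Fin 4) : ℝ := if i = j then 1 else 0

/-- The plane–plane field-strength covariance built from a symmetric tensor `h` (the Hessian of the
propagator): `K(h)_{(μν),(ρσ)} = -h_{μρ}δ_{νσ} + h_{μσ}δ_{νρ} + h_{νρ}δ_{μσ} - h_{νσ}δ_{μρ}`, i.e.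
`⟨F_{μν}(x)F_{ρσ}(0)⟩` for `⟨A_νA_σ⟩ = δ_{νσ}D`, `h = ∇∇D(x)`, restricted to the planes `μ<ν`, `ρ<σ`.
[folklore] -/
def K (h : Matrix (Fin 4) (Fin 4) ℝ) : Matrix (Fin 6) (Fin 6) ℝ := fun i j =>
  -h (p1 i) (p1 j) * δ (p2 i) (p2 j) + h (p1 i) (p2 j) * δ (p2 i) (p1 j)
    + h (p2 i) (p1 j) * δ (p1 i) (p2 j) - h (p2 i) (p2 j) * δ (p1 i) (p1 j)

/-- The Hodge star on 2-forms of Euclidean `ℝ⁴` in the plane basis: `⋆e₀₁ = e₂₃, ⋆e₀₂ = -e₁₃,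
⋆e₀₃ = e₁₂` and symmetrically — a symmetric signed permutation matrix. [folklore] -/
def S : Matrix (Fin 6) (Fin 6) ℝ := fun i j =>
  if i.val + j.val = 5 then (if i.val = 1 ∨ i.val = 4 then -1 else 1) else 0

/-- `⋆⋆ = 1` on 2-forms of `ℝ⁴`. [folklore] -/
theorem S_mul_S : S * S = 1 := by
  ext i j
  fin_cases i <;> fin_cases j <;> simp +decide [Matrix.mul_apply, Fin.sum_univ_succ, S]

set_option maxHeartbeats 2000000 in
/-- `K(h)` anticommutes with `⋆` when `h` is symmetric and traceless (entries given as rewrite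
hypotheses): it exchanges self-dual and anti-self-dual 2-forms — the traceless-Ricci block of the
four-dimensional curvature decomposition. [folklore] -/
theorem K_anticomm (h : Matrix (Fin 4) (Fin 4) ℝ) (h10 : h 1 0 = h 0 1) (h20 : h 2 0 = h 0 2)
    (h30 : h 3 0 = h 0 3) (h21 : h 2 1 = h 1 2) (h31 : h 3 1 = h 1 3) (h32 : h 3 2 = h 2 3)
    (h33 : h 3 3 = -(h 0 0 + h 1 1 + h 2 2)) : K h * S = -(S * K h) := by
  ext i j
  fin_cases i <;> fin_cases j <;>
    simp +decide [Matrix.mul_apply, Fin.sum_univ_succ, S, K, p1, p2, δ, h10, h20, h30, h21, h31, h32,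
      h33] <;> ring

/-- `K(h)` anticommutes with `⋆` for every traceless symmetric `h`. [folklore] -/
theorem K_anticomm' (h : Matrix (Fin 4) (Fin 4) ℝ) (hs : h.IsSymm) (ht : h.trace = 0) :
    K h * S = -(S * K h) := by
  have ht' : h 0 0 + h 1 1 + h 2 2 + h 3 3 = 0 := by
    simpa [Matrix.trace, Fin.sum_univ_four] using ht
  exact K_anticomm h (hs.apply 0 1) (hs.apply 0 2) (hs.apply 0 3) (hs.apply 1 2) (hs.apply 1 3)
    (hs.apply 2 3) (by linarith)

/-- Three operators anticommuting with an involution have a traceless product: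
`tr(ABC) = tr(T·ABC·T) = -tr(ABC)`. [folklore] -/
theorem trace_eq_zero_of_anticomm {n : Type*} [Fintype n] [DecidableEq n] {T A B C : Matrix n n ℝ}
    (hT : T * T = 1) (hA : A * T = -(T * A)) (hB : B * T = -(T * B)) (hC : C * T = -(T * C)) :
    Matrix.trace (A * B * C) = 0 := by
  have hA' : T * A = -(A * T) := by rw [hA, neg_neg]
  have hB' : T * B = -(B * T) := by rw [hB, neg_neg]
  have hC' : T * C = -(C * T) := by rw [hC, neg_neg]
  have h1 : T * (A * B * C) * T = -(A * B * C) := by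
    calc T * (A * B * C) * T = (T * A) * B * C * T := by noncomm_ring
      _ = -(A * (T * B) * C * T) := by rw [hA']; noncomm_ring
      _ = A * B * (T * C) * T := by rw [hB']; noncomm_ring
      _ = -(A * B * C * (T * T)) := by rw [hC']; noncomm_ring
      _ = -(A * B * C) := by rw [hT, Matrix.mul_one]
  have h2 : Matrix.trace (T * (A * B * C) * T) = Matrix.trace (A * B * C) := by
    rw [Matrix.trace_mul_cycle, hT, Matrix.one_mul]
  rw [h1, Matrix.trace_neg] at h2
  linarith

/-- **The tree-level skewness of `F_{μν}F_{μν}` vanishes in `d = 4`.** For traceless symmetric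
`h₁ h₂ h₃` (the Hessians of the harmonic propagator `|x|⁻²` at the three separations `x-y`, `y-z`,
`z-x`) the triangle `tr K(h₁)K(h₂)K(h₃)` — `1/64` of the free-field third cumulant of
`∑_{μν} F_{μν}²` at `x, y, z` — is zero. The same argument kills every odd ring, hence all odd
truncated functions of the free Wick square `F²`; the crux's "free Wick square" support is void and
its self-normalised skewness is `O(g²)` at weak coupling. [folklore] -/
theorem treeLevelSkewness_vanishes (h₁ h₂ h₃ : Matrix (Fin 4) (Fin 4) ℝ)
    (hs₁ : h₁.IsSymm) (hs₂ : h₂.IsSymm) (hs₃ : h₃.IsSymm)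
    (ht₁ : h₁.trace = 0) (ht₂ : h₂.trace = 0) (ht₃ : h₃.trace = 0) :
    Matrix.trace (K h₁ * K h₂ * K h₃) = 0 :=
  trace_eq_zero_of_anticomm S_mul_S (K_anticomm' h₁ hs₁ ht₁) (K_anticomm' h₂ hs₂ ht₂)
    (K_anticomm' h₃ hs₃ ht₃)

/-- The traceless symmetric `diag(1, 0, 0, -1)` (a sample Hessian direction). [folklore] -/
def h₀ : Matrix (Fin 4) (Fin 4) ℝ := fun i j =>
  if i = 0 ∧ j = 0 then 1 else if i = 3 ∧ j = 3 then -1 else 0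

/-- Non-degeneracy of the certificate: the two-point ring `tr K(h₀)K(h₀)` is not zero, so `K` is
not the zero map and the EVEN cumulants of the free Wick square `F²` do not vanish for this reason
(the free field has `κ₂ > 0`, `κ₄ ≠ 0`). [folklore] -/
theorem trace_K_h₀_sq_ne_zero : Matrix.trace (K h₀ * K h₀) ≠ 0 := by
  simp +decide [Matrix.trace, Matrix.mul_apply, Fin.sum_univ_succ, K, h₀, p1, p2, δ]
  norm_num

end Summit.QuantumFields.YangMills.Theorems.SelfNormalisedSkewness.Negative
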